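import Summits.KontsevichZagierPeriods.KontsevichZagierPeriods.Theses.HurwitzMicroSectors
import Literature.NumberTheory.Transcendental.BoxIntegralZetaValues

/-!
# `BoxIntegralZetaTwo` (stmt-KontsevichZagierPeriods-3875, route `HurwitzMicroSectors`)

The support item: the kernel `1/(1 − x₀x₁)` is integrable on the open unit box `(0,1)²` of
`Fin 2 → ℝ` and `∫∫ dx₀dx₁/(1 − x₀x₁) = π²/6` — Kontsevich–Zagier's own first example of a period
(KZ2001 §1.1; Beukers' double integral for `ζ(2)`).

This is exactly the tree's Literature theorem
`Literature.NumberTheory.Transcendental.box_integral_one_div_one_sub_mul_two`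
(`Literature/NumberTheory/Transcendental/BoxIntegralZetaValues.lean`: geometric series, term-wise
integration over the product measure, `hasSum_zeta_two`), so the closing theorem is a direct
reference; nothing is restated here.
-/

namespace Summit.KontsevichZagierPeriods.HurwitzMicroSectors.BoxIntegralZetaTwo

open Summit.KontsevichZagierPeriods.KontsevichZagierPeriods.Theses.HurwitzMicroSectors
  (BoxIntegralZetaTwo)

/-- **`BoxIntegralZetaTwo`** (item stmt-KontsevichZagierPeriods-3875): `1/(1 − x₀x₁)` is integrable on
the open unit box `{x : Fin 2 → ℝ | ∀ i, x i ∈ (0,1)}` and its integral there is `π²/6 = ζ(2)`.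
Proof: the tree's `box_integral_one_div_one_sub_mul_two` verbatim. [folklore] -/
theorem boxIntegralZetaTwo_proof : BoxIntegralZetaTwo := by
  unfold BoxIntegralZetaTwo
  exact Literature.NumberTheory.Transcendental.box_integral_one_div_one_sub_mul_two

end Summit.KontsevichZagierPeriods.HurwitzMicroSectors.BoxIntegralZetaTwo
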